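import Mathlib
import HarnessLib
import Literature.MathematicalPhysics.StatisticalMechanics.TorusFRDStepKernelMultipliers

/-!
# The ball of tuning parameters `q`: every small symmetric `q` is `T·B` with `B` unit symmetric,
# and segments between two such `q` stay elliptic ([ABKM19] Ch. 12, the set `B_κ(0) ⊂ ℝ^{d×d}_sym`)

The fine tuning of [ABKM19] Ch. 12 runs over symmetric matrices `q` with `‖q‖ ≤ κ`; the step-kernel
estimates of this tree (`stepKernelBounds_of_torusFRD`, `abs_re_fourierCoeff_sub_le_of_torusFRD`) are
phrased for `q = T·B` with `B` unit symmetric (`IsUnitSymm`), `0 ≤ T ≤ ½`, and for elliptic segments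
`A₀ + tB`.  This file provides the bookkeeping that connects the two descriptions, with the entry norm
`Σ_{ij} |q_{ij}|` as the size of `q` (it dominates the numerical radius):

* **`abs_quadForm_le_entrySum_mul`** — `|zᵀqz| ≤ (Σ|q_{ij}|) |z|²`;
* **`isUnitSymm_inv_smul`** — `B = (Σ|q_{ij}|)⁻¹ q` (more generally `T⁻¹q` with `Σ|q_{ij}| ≤ T`, `T > 0`)
  is unit symmetric, and `q = T·(T⁻¹q)` (`smul_inv_smul_eq`);
* **`isElliptic_one_add_of_entrySum_le`** — `1 + m ∈ 𝓛(½, 2)` when `m` is symmetric with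
  `Σ|m_{ij}| ≤ ½`;
* **`entrySum_convexComb_le`**, **`isElliptic_segment_of_entrySum_le`**, `segment_end` — the segment
  `1 + m + t·(T⁻¹(m' − m))`, `t ∈ [0,T]`, between two such parameters stays in `𝓛(½, 2)` and ends at
  `1 + m'`.

Everything is proved; no named fact.

## References
* S. Adams, S. Buchholz, R. Kotecký, S. Müller, arXiv:1910.13564, Ch. 12 (the ball `B_κ(0)`),
  Lemma 7.7 [AdamsBuchholzKoteckyMuller2019].
* S. Buchholz, J. Funct. Anal. 275 (2018), Thm 2.4 (the direction `Ȧ`, `|Ȧ| ≤ 1`) [Buchholz2016].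
-/

noncomputable section

namespace Literature.MathematicalPhysics.StatisticalMechanics.GradientRG

open scoped BigOperators
open Real Set Finset
open Literature.MathematicalPhysics.StatisticalMechanics.GradientFRD (IsElliptic IsUnitSymm)

variable {d : ℕ}

/-! ## The entry norm dominates the quadratic form -/

/-- **`|zᵀqz| ≤ (Σ_{ij}|q_{ij}|) · |z|²`** (`|z_i z_j| ≤ |z|²`). [cite: Buchholz2016, Thm 2.4] -/
theorem abs_quadForm_le_entrySum_mul (q : Matrix (Fin d) (Fin d) ℝ) (z : Fin d → ℝ) :
    |∑ i, ∑ j, z i * q i j * z j| ≤ (∑ i, ∑ j, |q i j|) * ∑ i, z i ^ 2 := by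
  set S := ∑ i, z i ^ 2 with hS
  have hS0 : 0 ≤ S := by positivity
  have hzz : ∀ i j, |z i| * |z j| ≤ S := by
    intro i j
    have h2 := two_mul_le_add_sq |z i| |z j|
    have hi : |z i| ^ 2 ≤ S := by
      rw [sq_abs]; exact single_le_sum (f := fun k => z k ^ 2) (fun k _ => sq_nonneg _) (mem_univ i)
    have hj : |z j| ^ 2 ≤ S := by
      rw [sq_abs]; exact single_le_sum (f := fun k => z k ^ 2) (fun k _ => sq_nonneg _) (mem_univ j)
    nlinarith
  calc |∑ i, ∑ j, z i * q i j * z j| ≤ ∑ i, |∑ j, z i * q i j * z j| := abs_sum_le_sum_abs _ _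
    _ ≤ ∑ i, ∑ j, |z i * q i j * z j| := sum_le_sum fun i _ => abs_sum_le_sum_abs _ _
    _ ≤ ∑ i, ∑ j, |q i j| * S := by
        refine sum_le_sum fun i _ => sum_le_sum fun j _ => ?_
        rw [abs_mul, abs_mul]
        calc |z i| * |q i j| * |z j| = |q i j| * (|z i| * |z j|) := by ring
          _ ≤ |q i j| * S := mul_le_mul_of_nonneg_left (hzz i j) (abs_nonneg _)
    _ = (∑ i, ∑ j, |q i j|) * S := by rw [sum_mul]; exact sum_congr rfl fun i _ => by rw [sum_mul]

/-! ## `q = T · B` with `B` unit symmetric -/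

/-- **`T⁻¹q` is unit symmetric** for symmetric `q` with `Σ|q_{ij}| ≤ T`, `T > 0`.
[cite: Buchholz2016, Thm 2.4] -/
theorem isUnitSymm_inv_smul {q : Matrix (Fin d) (Fin d) ℝ} (hq : q.IsSymm) {T : ℝ} (hT0 : 0 < T)
    (hT : ∑ i, ∑ j, |q i j| ≤ T) : IsUnitSymm (T⁻¹ • q) := by
  refine ⟨hq.smul _, fun z => ?_⟩
  have h : ∑ i, ∑ j, z i * (T⁻¹ • q) i j * z j = T⁻¹ * ∑ i, ∑ j, z i * q i j * z j := by
    rw [mul_sum]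
    refine sum_congr rfl fun i _ => ?_
    rw [mul_sum]
    refine sum_congr rfl fun j _ => ?_
    simp only [Matrix.smul_apply, smul_eq_mul]; ring
  rw [h, abs_mul, abs_of_pos (inv_pos.2 hT0)]
  have hz : 0 ≤ ∑ i, z i ^ 2 := by positivity
  calc T⁻¹ * |∑ i, ∑ j, z i * q i j * z j| ≤ T⁻¹ * ((∑ i, ∑ j, |q i j|) * ∑ i, z i ^ 2) :=
        mul_le_mul_of_nonneg_left (abs_quadForm_le_entrySum_mul q z) (inv_pos.2 hT0).le
    _ ≤ T⁻¹ * (T * ∑ i, z i ^ 2) :=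
        mul_le_mul_of_nonneg_left (mul_le_mul_of_nonneg_right hT hz) (inv_pos.2 hT0).le
    _ = ∑ i, z i ^ 2 := by rw [← mul_assoc, inv_mul_cancel₀ hT0.ne', one_mul]

/-- `q = T · (T⁻¹ q)` for `T ≠ 0`. [cite: Buchholz2016, Thm 2.4] -/
theorem smul_inv_smul_eq {q : Matrix (Fin d) (Fin d) ℝ} {T : ℝ} (hT : T ≠ 0) : T • (T⁻¹ • q) = q := by
  rw [smul_smul, mul_inv_cancel₀ hT, one_smul]

/-! ## Ellipticity of `1 + m` and of segments -/

/-- **`1 + m ∈ 𝓛(½, 2)`** for symmetric `m` with `Σ|m_{ij}| ≤ ½`: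
`½|z|² ≤ zᵀ(1+m)z ≤ (3/2)|z|² ≤ 2|z|²`. [cite: AdamsBuchholzKoteckyMuller2019, Lemma 7.7 (κ ≤ ω₀/2)] -/
theorem isElliptic_one_add_of_entrySum_le {m : Matrix (Fin d) (Fin d) ℝ} (hm : m.IsSymm)
    (h : ∑ i, ∑ j, |m i j| ≤ 1 / 2) :
    IsElliptic (1 / 2 : ℝ) 2 ((1 : Matrix (Fin d) (Fin d) ℝ) + m) := by
  by_cases hd0 : ∑ i, ∑ j, |m i j| = 0
  · -- `m = 0`
    have hm0 : m = 0 := by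
      ext i j
      have hij : |m i j| = 0 := by
        have hle : |m i j| ≤ ∑ i, ∑ j, |m i j| :=
          (single_le_sum (f := fun j => |m i j|) (fun _ _ => abs_nonneg _) (mem_univ j)).trans
            (single_le_sum (f := fun i => ∑ j, |m i j|) (fun _ _ => sum_nonneg fun _ _ => abs_nonneg _)
              (mem_univ i))
        exact le_antisymm (hd0 ▸ hle) (abs_nonneg _)
      simpa using hij
    rw [hm0, add_zero]; exact GradientFRD.isElliptic_one
  · have hpos : 0 < ∑ i, ∑ j, |m i j| :=
      lt_of_le_of_ne (sum_nonneg fun _ _ => sum_nonneg fun _ _ => abs_nonneg _) (Ne.symm hd0)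
    have hB := isUnitSymm_inv_smul hm hpos le_rfl
    have h1 := isElliptic_one_add_smul hB hpos.le h
    rwa [smul_inv_smul_eq hpos.ne'] at h1

/-- The entry norm of a convex combination: `Σ|(1−s)m + s m'| ≤ max(Σ|m|, Σ|m'|)` for `s ∈ [0,1]`.
[cite: AdamsBuchholzKoteckyMuller2019, Ch. 12 (convexity of B_κ(0))] -/
theorem entrySum_convexComb_le {m m' : Matrix (Fin d) (Fin d) ℝ} {s : ℝ} (hs0 : 0 ≤ s) (hs1 : s ≤ 1) :
    ∑ i, ∑ j, |((1 - s) • m + s • m') i j| ≤ max (∑ i, ∑ j, |m i j|) (∑ i, ∑ j, |m' i j|) := by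
  set a := ∑ i, ∑ j, |m i j| with ha
  set b := ∑ i, ∑ j, |m' i j| with hb
  calc ∑ i, ∑ j, |((1 - s) • m + s • m') i j| ≤ ∑ i, ∑ j, ((1 - s) * |m i j| + s * |m' i j|) := by
        refine sum_le_sum fun i _ => sum_le_sum fun j _ => ?_
        simp only [Matrix.add_apply, Matrix.smul_apply, smul_eq_mul]
        calc |(1 - s) * m i j + s * m' i j| ≤ |(1 - s) * m i j| + |s * m' i j| := abs_add_le _ _
          _ = (1 - s) * |m i j| + s * |m' i j| := by
              rw [abs_mul, abs_mul, abs_of_nonneg (by linarith), abs_of_nonneg hs0]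
    _ = (1 - s) * a + s * b := by
        simp only [sum_add_distrib, ← mul_sum, ha, hb]
    _ ≤ (1 - s) * max a b + s * max a b :=
        add_le_add (mul_le_mul_of_nonneg_left (le_max_left _ _) (by linarith))
          (mul_le_mul_of_nonneg_left (le_max_right _ _) hs0)
    _ = max a b := by ring

/-- The segment from `1 + m` in the direction `T⁻¹(m' − m)` at time `t ∈ [0,T]` is `1 +` the convex
combination `(1 − t/T)m + (t/T)m'`. [cite: AdamsBuchholzKoteckyMuller2019, Ch. 12] -/
theorem segment_eq_one_add_convexComb (m m' : Matrix (Fin d) (Fin d) ℝ) (T t : ℝ) :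
    (1 : Matrix (Fin d) (Fin d) ℝ) + m + t • (T⁻¹ • (m' - m)) =
      1 + ((1 - t / T) • m + (t / T) • m') := by
  rw [add_assoc, smul_smul, ← div_eq_mul_inv, smul_sub, sub_smul, one_smul]
  congr 1
  abel

/-- The segment ends at `1 + m'`. [cite: AdamsBuchholzKoteckyMuller2019, Ch. 12] -/
theorem segment_end {m m' : Matrix (Fin d) (Fin d) ℝ} {T : ℝ} (hT : T ≠ 0) :
    (1 : Matrix (Fin d) (Fin d) ℝ) + m + T • (T⁻¹ • (m' - m)) = 1 + m' := by
  rw [segment_eq_one_add_convexComb, div_self hT, sub_self, zero_smul, one_smul, zero_add]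

/-- **Segments between small tuning parameters are elliptic**: for symmetric `m, m'` with
`Σ|m_{ij}|, Σ|m'_{ij}| ≤ ½` and `T > 0`, every point `1 + m + t·T⁻¹(m' − m)`, `t ∈ [0,T]`, lies in
`𝓛(½, 2)` — the hypothesis `hell` of `re_fourierCoeff_le_one_add_mul_of_torusFRD` /
`abs_re_fourierCoeff_sub_le_of_torusFRD` for the pair `1 + m`, `1 + m'`.
[cite: AdamsBuchholzKoteckyMuller2019, Lemma 7.7 / Ch. 12] -/
theorem isElliptic_segment_of_entrySum_le {m m' : Matrix (Fin d) (Fin d) ℝ} (hm : m.IsSymm)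
    (hm' : m'.IsSymm) (h : ∑ i, ∑ j, |m i j| ≤ 1 / 2) (h' : ∑ i, ∑ j, |m' i j| ≤ 1 / 2)
    {T : ℝ} (hT : 0 < T) :
    ∀ t ∈ Icc (0 : ℝ) T,
      IsElliptic (1 / 2 : ℝ) 2 ((1 : Matrix (Fin d) (Fin d) ℝ) + m + t • (T⁻¹ • (m' - m))) := by
  intro t ht
  rw [segment_eq_one_add_convexComb]
  have hs0 : 0 ≤ t / T := div_nonneg ht.1 hT.le
  have hs1 : t / T ≤ 1 := (div_le_one hT).2 ht.2
  refine isElliptic_one_add_of_entrySum_le ((hm.smul _).add (hm'.smul _)) ?_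
  exact (entrySum_convexComb_le hs0 hs1).trans (max_le h h')

/-- The direction of the segment is unit symmetric when `T ≥ Σ|m' − m|` (`T > 0`).
[cite: Buchholz2016, Thm 2.4] -/
theorem isUnitSymm_direction {m m' : Matrix (Fin d) (Fin d) ℝ} (hm : m.IsSymm) (hm' : m'.IsSymm)
    {T : ℝ} (hT0 : 0 < T) (hT : ∑ i, ∑ j, |(m' - m) i j| ≤ T) : IsUnitSymm (T⁻¹ • (m' - m)) :=
  isUnitSymm_inv_smul (hm'.sub hm) hT0 hT

end Literature.MathematicalPhysics.StatisticalMechanics.GradientRG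

end
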